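import Summits.BirchSwinnertonDyer.BirchSwinnertonDyer.Theorems.ClassRecordThreeShimuraKolyvaginOrderBoundAtThreeRungSEmpty
import Summits.BirchSwinnertonDyer.BirchSwinnertonDyer.Theses.ClassRecordThree
import Summits.BirchSwinnertonDyer.BirchSwinnertonDyer.Theses.KolyvaginRoadThree
import HarnessLib

/-!
# BC5 rung `stub_rung_orderBound_SEmptyAtThree` of crux `ShimuraKolyvaginOrderBoundAtThree` (item
# 19616) from each ROUTE'S OWN published-inputs binder — no input beyond what `closes` already carries

Cell `bsd-stepL` (run/shared/lean/pub/bsd-stepL/), seat `bsd-stepL-shim-p2` (gen 2). The crux item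
stmt-BirchSwinnertonDyer-19616 `ShimuraKolyvaginOrderBoundAtThree` is shared by the routes
`route-BirchSwinnertonDyer-ClassRecordThree` (K2@3) and `route-BirchSwinnertonDyer-KolyvaginRoadThree`
(KOLY). Its registered skeleton (`Cruxes/ShimuraKolyvaginOrderBoundAtThree/Lines/birth.lean`, v4) carries
the plan-only BC5 rung `stub_rung_orderBound_SEmptyAtThree` (the case `S = ∅`, `N⁻ = 1`: the Shimura
curve is `X₀(N)` and Kolyvagin's order bound is PRINTED — Cha 2005 Thm. 21, Matar–Nekovář 2019 Thm. 0.3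
+ §0.11). Gen 0 of this seat proved the rung's registered signature verbatim as the conclusion of
`ShimuraKolyvaginRungSEmpty.stub_rung_orderBound_SEmptyAtThree_of_published`, conditional on three named
published facts (`gross_zagier`, `kolyvagin`, `MatarNekovar2019.thm03_padicValNat_card_sha_le_of_irreducible`).

THIS FILE records the one bookkeeping fact that matters for the routes: those three facts are conjuncts
1, 2 and 19 of the K2@3 route's own support binder `Theses.ClassRecordThree.PublishedInputsThree` (item
stmt-BirchSwinnertonDyer-19112, "the twenty PUBLISHED named facts of the class record", a hypothesis of
that route's `closes` theorem) and of the first component of the KOLY route's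
`Theses.KolyvaginRoadThree.PublishedInputsKolyThree`. Hence **the rung holds under each route's standing
published-inputs hypothesis ALONE** — it consumes no open item, no residual, and no named fact the route
does not already display:

* `stub_rung_orderBound_SEmptyAtThree_of_publishedInputsThree` — `PublishedInputsThree →` (registered
  rung signature, verbatim);
* `stub_rung_orderBound_SEmptyAtThree_of_publishedInputsKolyThree` — `PublishedInputsKolyThree →` (the
  same signature).

HONEST FRAMING: theorems only; CONDITIONAL on the displayed published inputs (exactly as the routes'
`closes` theorems are); nothing booked; the registered stub itself (whose header has no fact binders) is
not closed by name by this file, and the crux proper (`S ≠ ∅`, genuine Shimura curves at `3 ∣ N⁺`) is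
untouched and OPEN. References: [Cha2005] Thm. 21 (p. 173); [MatarNekovar2019] Thm. 0.3, §0.4, §0.11
(pp. 456–457); [GrossZagier1986] I.(6.5); [GrossLMS1991] Thm. 1.3.
-/

noncomputable section

open scoped Classical

set_option linter.dupNamespace false

open WeierstrassCurve NumberField Literature.NumberTheory.EllipticCurves
  Literature.NumberTheory.EllipticCurves.ModularForms
  Literature.NumberTheory.EllipticCurves.Rank1Residual
  Literature.NumberTheory.Automorphic CongruenceSubgroup

namespace Summit.BirchSwinnertonDyer.BirchSwinnertonDyer.Theorems.ShimuraKolyvaginRungSEmpty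

/-- **The BC5 rung of crux 19616 under the K2@3 route's own published-inputs binder.** If
`PublishedInputsThree` (route `ClassRecordThree`, item stmt-BirchSwinnertonDyer-19112: the twenty
published named facts of the class record, a standing hypothesis of the route's `closes` theorem) holds,
then the registered signature of `stub_rung_orderBound_SEmptyAtThree` holds verbatim: for a globally
minimal `W/ℚ` of conductor `N` with `E[3]` irreducible, `K` imaginary quadratic with every `ℓ ∣ N` split
(`S = ∅`, so the Shimura curve datum has level `(1, N)`, i.e. `X₀(N)`), `3 ∣ N` split in `K`, `P₀`
class-minimal for `W`, and any non-torsion `P ∈ E(K)` carrying the Cai–Shu–Tian display with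
`ord_3 degS = ord_3 deg P₀`, one has `#Ш(E/K)[3^∞] ≤ 3^{2·ord_3 [E(K):ℤP]}`. Proof: conjuncts 1
(`gross_zagier`), 2 (`kolyvagin`) and 19 (`MatarNekovar2019.thm03_padicValNat_card_sha_le_of_irreducible`)
of the binder feed `stub_rung_orderBound_SEmptyAtThree_of_published`. CONDITIONAL on the displayed
published inputs; nothing booked. [cite: MatarNekovar2019, Thm. 0.3 (p. 456), §0.4, §0.11 (p. 457)]
[cite: Cha2005, Thm. 21 (p. 173)] [cite: GrossLMS1991, Thm. 1.3] -/
theorem stub_rung_orderBound_SEmptyAtThree_of_publishedInputsThree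
    (h : Summit.BirchSwinnertonDyer.BirchSwinnertonDyer.Theses.ClassRecordThree.PublishedInputsThree) :
  ∀ (W : WeierstrassCurve ℚ) [W.IsElliptic] [W.IsGloballyMinimal] (p : ℕ) [Fact p.Prime]
    (N : ℕ) [NeZero N] (K : Type) [Field K] [NumberField K] (S : Finset ℕ)
    (Dt : ModularParametrizationData W N)
    (X : ShimuraCurveData (∏ q ∈ S, q) (N / ∏ q ∈ S, q))
    (W' : WeierstrassCurve ℚ) [W'.IsElliptic] (P₀ : ShimuraParametrizationData X W'),
    W.conductorNorm ℤ = N → S = ∅ → p ≠ 2 → W.HasIrreducibleModPGaloisRep p →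
    IsImaginaryQuadratic K → Even S.card →
    (∀ ℓ ∈ S, ℓ.Prime ∧ ℓ ∣ N ∧ ¬ ℓ ^ 2 ∣ N ∧
      ((Ideal.span {(ℓ : ℤ)}).primesOver (𝓞 K)).ncard = 1 ∧ ¬ (ℓ : ℤ) ∣ NumberField.discr K) →
    (∀ ℓ : ℕ, ℓ.Prime → ℓ ∣ N → ℓ ∉ S → ((Ideal.span {(ℓ : ℤ)}).primesOver (𝓞 K)).ncard = 2) →
    ((Ideal.span {(p : ℤ)}).primesOver (𝓞 K)).ncard = 2 →
    P₀.IsMinimalFor W →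
    p ∣ N → p = 3 →
    ∀ (P : (W.baseChange K).toAffine.Point) (degS : ℕ), 0 < degS →
      padicValNat p degS = padicValNat p P₀.deg →
      LDerivEK W K =
        8 * (Real.pi : ℂ) ^ 2 * peterssonProduct (Gamma0 N) 2 Dt.f Dt.f /
            ((((Units.torsionOrder K : ℝ) / 2) ^ 2 * √|(NumberField.discr K : ℝ)| : ℝ) : ℂ) *
          ((P.canonicalHeight : ℂ) / (degS : ℂ)) →
      ¬ IsOfFinAddOrder P →
        Nat.card (AddCommGroup.primaryComponent (W.baseChange K).sha p) ≤
          p ^ (2 * padicValNat p (AddSubgroup.zmultiples P).index) := by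
  obtain ⟨hGZ, hKol, -, -, -, -, -, -, -, -, -, -, -, -, -, -, -, -, hMN, -⟩ := h
  exact stub_rung_orderBound_SEmptyAtThree_of_published hGZ hKol hMN

/-- **The BC5 rung of crux 19616 under the KOLY route's own published-inputs binder.** If
`PublishedInputsKolyThree` (route `KolyvaginRoadThree`: the class record's twenty published facts plus
McCallum's structure certificate, complex conjugation on `y_1` and the Kolyvagin–Heegner data supply, a
standing hypothesis of that route's `closes` theorem) holds, then the registered signature of
`stub_rung_orderBound_SEmptyAtThree` holds verbatim (same statement as
`stub_rung_orderBound_SEmptyAtThree_of_publishedInputsThree`). Proof: the first component of the binder is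
the class record's conjunction; its conjuncts 1, 2, 19 feed `stub_rung_orderBound_SEmptyAtThree_of_published`.
CONDITIONAL on the displayed published inputs; nothing booked.
[cite: MatarNekovar2019, Thm. 0.3 (p. 456), §0.4, §0.11 (p. 457)] [cite: Cha2005, Thm. 21 (p. 173)]
[cite: GrossLMS1991, Thm. 1.3] -/
theorem stub_rung_orderBound_SEmptyAtThree_of_publishedInputsKolyThree
    (h : Summit.BirchSwinnertonDyer.BirchSwinnertonDyer.Theses.KolyvaginRoadThree.PublishedInputsKolyThree) :
  ∀ (W : WeierstrassCurve ℚ) [W.IsElliptic] [W.IsGloballyMinimal] (p : ℕ) [Fact p.Prime]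
    (N : ℕ) [NeZero N] (K : Type) [Field K] [NumberField K] (S : Finset ℕ)
    (Dt : ModularParametrizationData W N)
    (X : ShimuraCurveData (∏ q ∈ S, q) (N / ∏ q ∈ S, q))
    (W' : WeierstrassCurve ℚ) [W'.IsElliptic] (P₀ : ShimuraParametrizationData X W'),
    W.conductorNorm ℤ = N → S = ∅ → p ≠ 2 → W.HasIrreducibleModPGaloisRep p →
    IsImaginaryQuadratic K → Even S.card →
    (∀ ℓ ∈ S, ℓ.Prime ∧ ℓ ∣ N ∧ ¬ ℓ ^ 2 ∣ N ∧
      ((Ideal.span {(ℓ : ℤ)}).primesOver (𝓞 K)).ncard = 1 ∧ ¬ (ℓ : ℤ) ∣ NumberField.discr K) →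
    (∀ ℓ : ℕ, ℓ.Prime → ℓ ∣ N → ℓ ∉ S → ((Ideal.span {(ℓ : ℤ)}).primesOver (𝓞 K)).ncard = 2) →
    ((Ideal.span {(p : ℤ)}).primesOver (𝓞 K)).ncard = 2 →
    P₀.IsMinimalFor W →
    p ∣ N → p = 3 →
    ∀ (P : (W.baseChange K).toAffine.Point) (degS : ℕ), 0 < degS →
      padicValNat p degS = padicValNat p P₀.deg →
      LDerivEK W K =
        8 * (Real.pi : ℂ) ^ 2 * peterssonProduct (Gamma0 N) 2 Dt.f Dt.f /
            ((((Units.torsionOrder K : ℝ) / 2) ^ 2 * √|(NumberField.discr K : ℝ)| : ℝ) : ℂ) *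
          ((P.canonicalHeight : ℂ) / (degS : ℂ)) →
      ¬ IsOfFinAddOrder P →
        Nat.card (AddCommGroup.primaryComponent (W.baseChange K).sha p) ≤
          p ^ (2 * padicValNat p (AddSubgroup.zmultiples P).index) := by
  obtain ⟨⟨hGZ, hKol, -, -, -, -, -, -, -, -, -, -, -, -, -, -, -, -, hMN, -⟩, -⟩ := h
  exact stub_rung_orderBound_SEmptyAtThree_of_published hGZ hKol hMN

end Summit.BirchSwinnertonDyer.BirchSwinnertonDyer.Theorems.ShimuraKolyvaginRungSEmpty

end
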